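import Literature.AnabelianGeometry.SemiGraphs.BranchActionOnFibre
import Literature.AnabelianGeometry.Anabelioids.QuotientAnabelioidProofs
import Mathlib.GroupTheory.Index

/-!
# Kernels of fibre actions under a change of basepoint; branch groups at other vertices ([SemiAnbd] §2)

Mochizuki, *Semi-graphs of anabelioids*, Publ. RIMS **42** (2006), §2, Definition 2.1 p. 23 ("natural
outer homomorphisms `Π_v → Π_𝒢`" — well defined up to conjugation, i.e. up to the choice of a
transport between basepoints) and Remark 2.2.1 p. 24 (decomposition groups as stabilisers)
[cite: MochizukiSemiAnbd2006, Rem. 2.2.1 p.24].  Proof-only bookkeeping (cell abc-iut, layer L3, row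
F-1477 / [SemiAnbd] Rmk. 2.10.1, sub-node (L5) "kernel transport" of `LevelEdgeSeparation`, seat
abc-iut-L3-t12) for the open normal subgroup `U_A := Ker(Π_𝒢 ↷ Φ(A))` defined by an object
`A ∈ B(𝒢)` at a basepoint `Φ`:

* `map_ker_toPermHom_autMulEquivOfIso` — along an isomorphism of basepoints `e : Φ ≅ Φ'` the
  transport `Aut Φ ≃* Aut Φ'` carries `Ker(Aut Φ ↷ Φ(X))` onto `Ker(Aut Φ' ↷ Φ'(X))`;
* `map_map_branchSubgroup_le_ker_of_edge_trivial` — hence if `A` is trivial over the edge of a branch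
  `b` at ANY vertex `w`, the image of `Π_b` in `Π_𝒢` computed at any other basepoint through a vertex
  `v` (via any transport `ρ_w ⋙ F_w ≅ ρ_v ⋙ F_v`, the shape used by the §2 covering dictionary) lies in
  the kernel `U_A` at `v`; and the non-trivial counterpart `not_map_map_branchSubgroup_le_ker_…`;
* `isOpen_ker_toPermHom` — `U_A` is an open (normal) subgroup (fibre functor
  actions are continuous);
* `exists_bObj_stabilizer_eq` — for an open normal `V ⊴ Π_𝒢` (any fibre-functor basepoint) there is
  an object `A_V ∈ B(𝒢)` whose fibre is `Π_𝒢/V`: every point has stabiliser `V` (the Galois covering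
  `𝒢_V`, sub-node (L1)).

No statement here takes a side on any disputed claim; nothing about [IUTchIII] Cor. 3.12.
-/

namespace Literature.AnabelianGeometry.SemiGraphs

open CategoryTheory CategoryTheory.PreGaloisCategory
open Literature.AnabelianGeometry.Anabelioids
open Topology

universe v₁ u₁ u w

/-! ### Generic: kernels of fibre actions under an isomorphism of basepoints -/

section Generic

variable {C : Type u₁} [Category.{v₁} C]

/-- Along an isomorphism of basepoints `e : Φ ≅ Φ'` ("well-defined up to conjugation", [GeoAn]
§1.1), the transported automorphism acts on `e_X(x)` as `e_X(σ · x)`.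
[cite: MochizukiGeoAn2004, §1.1 p.10] -/
theorem autMulEquivOfIso_smul_hom_app {Φ Φ' : C ⥤ FintypeCat.{w}} (e : Φ ≅ Φ') (X : C) (σ : Aut Φ)
    (x : Φ.obj X) : Aut.autMulEquivOfIso e σ • e.hom.app X x = e.hom.app X (σ • x) := by
  rw [mulAction_def, mulAction_def]
  change (e.inv ≫ σ.hom ≫ e.hom).app X (e.hom.app X x) = _
  simp only [NatTrans.comp_app, FintypeCat.comp_apply]
  rw [← FintypeCat.comp_apply (e.hom.app X) (e.inv.app X), ← NatTrans.comp_app, e.hom_inv_id,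
    NatTrans.id_app, FintypeCat.id_apply]

/-- **The kernel of the fibre action is transported along a change of basepoint**: for `e : Φ ≅ Φ'`
and an object `X`, `Aut Φ ≃* Aut Φ'` maps `Ker(Aut Φ ↷ Φ(X))` onto `Ker(Aut Φ' ↷ Φ'(X))`.
[cite: MochizukiSemiAnbd2006, Rem. 2.2.1 p.24] -/
theorem map_ker_toPermHom_autMulEquivOfIso {Φ Φ' : C ⥤ FintypeCat.{w}} (e : Φ ≅ Φ') (X : C) :
    (MulAction.toPermHom (Aut Φ) (Φ.obj X)).ker.map (Aut.autMulEquivOfIso e).toMonoidHom =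
      (MulAction.toPermHom (Aut Φ') (Φ'.obj X)).ker := by
  have hbij : Function.Bijective (e.hom.app X : Φ.obj X → Φ'.obj X) :=
    (FintypeCat.equivEquivIso.symm (e.app X)).bijective
  apply le_antisymm
  · rintro _ ⟨σ, hσ, rfl⟩
    replace hσ : MulAction.toPermHom (Aut Φ) (Φ.obj X) σ = 1 := hσ
    show MulAction.toPermHom (Aut Φ') (Φ'.obj X) (Aut.autMulEquivOfIso e σ) = 1
    ext x'
    obtain ⟨x, rfl⟩ := hbij.2 x'
    rw [MulAction.toPermHom_apply, MulAction.toPerm_apply, Equiv.Perm.coe_one, id_eq,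
      autMulEquivOfIso_smul_hom_app]
    have := congrArg (fun p : Equiv.Perm (Φ.obj X) => p x) hσ
    simp only [MulAction.toPermHom_apply, MulAction.toPerm_apply, Equiv.Perm.coe_one, id_eq] at this
    rw [this]
  · intro σ' hσ'
    replace hσ' : MulAction.toPermHom (Aut Φ') (Φ'.obj X) σ' = 1 := hσ'
    obtain ⟨σ, rfl⟩ := (Aut.autMulEquivOfIso e).surjective σ'
    refine ⟨σ, ?_, rfl⟩
    show MulAction.toPermHom (Aut Φ) (Φ.obj X) σ = 1
    ext x
    apply hbij.1
    rw [MulAction.toPermHom_apply, MulAction.toPerm_apply, Equiv.Perm.coe_one, id_eq,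
      ← autMulEquivOfIso_smul_hom_app]
    have := congrArg (fun p : Equiv.Perm (Φ'.obj X) => p (e.hom.app X x)) hσ'
    simp only [MulAction.toPermHom_apply, MulAction.toPerm_apply, Equiv.Perm.coe_one, id_eq] at this
    exact this

/-- For a fibre functor of a Galois category, the kernel of the action on a fibre is OPEN (the action
is continuous and the fibre finite). [cite: MochizukiSemiAnbd2006, Rem. 2.2.1 p.24] -/
theorem isOpen_ker_toPermHom [GaloisCategory C] (Φ : C ⥤ FintypeCat.{v₁}) [FiberFunctor Φ] (X : C) :
    IsOpen ((MulAction.toPermHom (Aut Φ) (Φ.obj X)).ker : Set (Aut Φ)) := by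
  have hker : ((MulAction.toPermHom (Aut Φ) (Φ.obj X)).ker : Set (Aut Φ)) =
      ⋂ x : Φ.obj X, (MulAction.stabilizer (Aut Φ) x : Set (Aut Φ)) := by
    ext σ
    simp only [SetLike.mem_coe, MonoidHom.mem_ker, Set.mem_iInter, MulAction.mem_stabilizer_iff]
    constructor
    · intro h x
      have := congrArg (fun p : Equiv.Perm (Φ.obj X) => p x) h
      simpa using this
    · intro h
      ext x
      simpa using h x
  rw [hker]
  exact isOpen_iInter_of_finite fun x => stabilizer_isOpen (Aut Φ) x

end Generic

/-! ### In `B(𝒢)`: branch groups at other vertices, and the Galois objects `A_V` -/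

namespace SemiGraphOfAnabelioids

variable {𝒢 : SemiGraphOfAnabelioids.{v₁, u₁, u}} (A : 𝒢.BObj)

/-- **Triviality over an edge forces the (transported) branch group into the kernel.**  If `A` is
trivial over the edge of a branch `b` abutting to `w` (`Π_e = Aut F_e` fixes `F_e(T_e)`), then for every
basepoint `F_w` of `𝒢_w`, transport `α_b`, basepoint `F_v` through another vertex `v` and transport of
basepoints of `B(𝒢)` `α : ρ_w ⋙ F_w ≅ ρ_v ⋙ F_v`, the image of `Π_b` in `Π_𝒢 = Aut(ρ_v ⋙ F_v)` lies in
`Ker(Π_𝒢 ↷ F_v(S_v))`. [cite: MochizukiSemiAnbd2006, Rem. 2.2.1 p.24] -/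
theorem map_map_branchSubgroup_le_ker_of_edge_trivial {w v : 𝒢.graph.Vertex}
    (Fw : 𝒢.V w ⥤ FintypeCat.{w}) (b : 𝒢.graph.Branch) (h : 𝒢.graph.abuts b = some w)
    (Fe : 𝒢.E (𝒢.graph.edgeOf b) ⥤ FintypeCat.{w}) (αb : (𝒢.pull b w h).pullback ⋙ Fe ≅ Fw)
    (Fv : 𝒢.V v ⥤ FintypeCat.{w}) (α : 𝒢.ρ w ⋙ Fw ≅ 𝒢.ρ v ⋙ Fv)
    (htriv : ∀ (σ : Aut Fe) (y : Fe.obj (A.T (𝒢.graph.edgeOf b))), σ • y = y) :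
    ((𝒢.branchSubgroup Fw b h Fe αb).map (𝒢.piVToPi w Fw)).map (Aut.autMulEquivOfIso α).toMonoidHom ≤
      (MulAction.toPermHom (𝒢.Pi v Fv) ((𝒢.ρ v ⋙ Fv).obj A)).ker := by
  rw [← map_ker_toPermHom_autMulEquivOfIso α A]
  exact Subgroup.map_mono (map_piVToPi_branchSubgroup_le_ker_of_edge_trivial A Fw b h Fe αb htriv)

/-- **Non-triviality over an edge keeps the (transported) branch group out of the kernel.**
[cite: MochizukiSemiAnbd2006, Rem. 2.2.1 p.24] -/
theorem not_map_map_branchSubgroup_le_ker_of_edge_nontrivial {w v : 𝒢.graph.Vertex}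
    (Fw : 𝒢.V w ⥤ FintypeCat.{w}) (b : 𝒢.graph.Branch) (h : 𝒢.graph.abuts b = some w)
    (Fe : 𝒢.E (𝒢.graph.edgeOf b) ⥤ FintypeCat.{w}) (αb : (𝒢.pull b w h).pullback ⋙ Fe ≅ Fw)
    (Fv : 𝒢.V v ⥤ FintypeCat.{w}) (α : 𝒢.ρ w ⋙ Fw ≅ 𝒢.ρ v ⋙ Fv)
    (hnt : ∃ (σ : Aut Fe) (y : Fe.obj (A.T (𝒢.graph.edgeOf b))), σ • y ≠ y) :
    ¬ ((𝒢.branchSubgroup Fw b h Fe αb).map (𝒢.piVToPi w Fw)).map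
        (Aut.autMulEquivOfIso α).toMonoidHom ≤
      (MulAction.toPermHom (𝒢.Pi v Fv) ((𝒢.ρ v ⋙ Fv).obj A)).ker := by
  rw [← map_ker_toPermHom_autMulEquivOfIso α A]
  intro hle
  apply not_map_piVToPi_branchSubgroup_le_ker_of_edge_nontrivial A Fw b h Fe αb hnt
  intro x hx
  have := hle (Subgroup.mem_map_of_mem _ hx)
  obtain ⟨y, hy, hyx⟩ := this
  rwa [← (Aut.autMulEquivOfIso α).injective hyx]

/-- **The Galois object `A_V`** (sub-node (L1) of `LevelEdgeSeparation`): for a fibre-functor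
basepoint `Φ = ρ_v ⋙ F` of `B(𝒢)` (e.g. `𝒢` connected) and an open normal `V ⊴ Π_𝒢 = Aut Φ`, there
is an object `A_V ∈ B(𝒢)` whose fibre is `Π_𝒢/V`: `[Π_𝒢 : V]` points, each of stabiliser exactly `V`
— the finite étale Galois covering `𝒢_V → 𝒢` of [SemiAnbd] p. 30 as an object of `B(𝒢)`.
[cite: MochizukiSemiAnbd2006, Cor. 2.7 p.30] -/
theorem exists_bObj_stabilizer_eq [GaloisCategory 𝒢.BObj] {v : 𝒢.graph.Vertex}
    (F : 𝒢.V v ⥤ FintypeCat.{w}) [FiberFunctor (𝒢.ρ v ⋙ F)] (V : Subgroup (𝒢.Pi v F))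
    [V.Normal] (hVo : IsOpen (V : Set (𝒢.Pi v F))) :
    ∃ AV : 𝒢.BObj, (∀ x : (𝒢.ρ v ⋙ F).obj AV, MulAction.stabilizer (𝒢.Pi v F) x = V) ∧
      Nat.card ((𝒢.ρ v ⋙ F).obj AV) = V.index := by
  obtain ⟨AV, y₀, -, hstab, htrans⟩ := exists_quotientObj (𝒢.ρ v ⋙ F) V hVo
  have hy₀ : MulAction.stabilizer (𝒢.Pi v F) y₀ = V := by
    ext σ
    rw [MulAction.mem_stabilizer_iff, mulAction_def]
    exact hstab σ
  have hall : ∀ x : (𝒢.ρ v ⋙ F).obj AV, MulAction.stabilizer (𝒢.Pi v F) x = V := by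
    intro x
    obtain ⟨σ, hσ⟩ := htrans x
    have hx : x = σ • y₀ := by rw [mulAction_def]; exact hσ.symm
    rw [hx, MulAction.stabilizer_smul_eq_stabilizer_map_conj, hy₀]
    ext z
    rw [Subgroup.mem_map_equiv, MulAut.conj_symm_apply]
    constructor
    · intro hz
      have := (inferInstance : V.Normal).conj_mem _ hz σ
      simpa [mul_assoc] using this
    · intro hz
      have := (inferInstance : V.Normal).conj_mem _ hz σ⁻¹
      simpa [mul_assoc] using this
  refine ⟨AV, hall, ?_⟩
  haveI : MulAction.IsPretransitive (𝒢.Pi v F) ((𝒢.ρ v ⋙ F).obj AV) :=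
    ⟨fun x y => by
      obtain ⟨σ, hσ⟩ := htrans x
      obtain ⟨τ, hτ⟩ := htrans y
      refine ⟨τ * σ⁻¹, ?_⟩
      have hx : σ • y₀ = x := hσ
      have hy : τ • y₀ = y := hτ
      rw [← hx, mul_smul, inv_smul_smul, hy]⟩
  rw [← hy₀]
  exact (MulAction.index_stabilizer_of_transitive (𝒢.Pi v F) y₀).symm

end SemiGraphOfAnabelioids

end Literature.AnabelianGeometry.SemiGraphs
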